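import Summits.QuantumFields.BalabanUV.T4Continuum.Spine.NE4.KingCurrency
import Summits.QuantumFields.BalabanUV.T4Continuum.Spine.NE4.KingCurrencyAF
import Summits.QuantumFields.BalabanUV.T4Continuum.Support.NE7PairwiseCouplingStep

/-!
# Spine/NE4/KingCurrencySummable — (R56) node U2 in King's currency WITHOUT geometric fading: the direct matching of two pinned runs from the
# rate-free n-shift input + history moduli whose influence is merely FORWARD-SUMMABLE (plus a UV-mass bound and a vanishing young tail) + the
# asymptotic-freedom binder; the flat memory of (R55)'s coupling-sensitive parabolic direction qualifies

Cell `pub-balaban-gaps` (YM blitz G2), seat `ne4`, generation 15 (unit `pub-balaban-gaps-ne4-g15`); record `HOME/ne/NE4.md` §5 (R56).  A variant of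
`KingCurrencyWindow` ((R51): the same END under `FadingMemory C θ Λ`, i.e. GEOMETRIC fading of the history moduli in the age).

HONEST FRAMING.  Bookkeeping on HYPOTHESIS SHAPES about Bałaban's history-dependent β-functions; NE4 (`ScaleShiftRate`) and every β-side input below are NOT IN PRINT
([Balaban1987RG1] = CMP **109** (1987) p. 264 «We will investigate other properties in a separate paper»); nothing of Bałaban's is asserted; the printed inputs are the
recursion (0.20) p. 256 and the renormalization conditions of Thm 2 p. 259 as hypotheses on abstract sequences.  One finite T⁴; NOT ℝ⁴, NOT infinite volume, NOT a mass
gap, NOT Clay.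

THE POINT.  (R55) (`AutonomousSchemeParabolicMemory`) exhibited a β-family — the coupling-sensitive parabolic caricature — with King's n-shift input `UniformShift ω → 0`, an
AF-type lower bound, and history moduli that are FLAT in the age (`Λ k i = 2∕(k+3)²` for every `i ≤ k`) — so `FadingMemory C θ Λ` fails for every θ < 1 and (R51)'s END
`KingCurrencyWindow.direct_matching_eventually` does not apply AS TYPED.  But (R51)'s window bootstrap spends the geometric fading in exactly three places: (a) the EXCHANGE
OF SUMS in the window feedback (`Σ_{j ≥ i} θ^{j−i} ≤ 1∕(1−θ)`), (b) the far-ultraviolet scales `k₀ ≤ i < J` (both couplings small by asymptotic freedom; total kernel mass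
`Σ_{j∈[J,K)} Σ_{i<J} θ^{j−i} ≤ θ∕(1−θ)²`), (c) the first `k₀` scales (no AF smallness; damped by `θ^{J−k₀}`).  This file re-runs the bootstrap with those three uses promoted
to HYPOTHESIS SHAPES on the moduli (§1): `ForwardSum Λ M` (the total FUTURE influence `Σ_{j∈[i,K)} Λ_{j,i}` of every coupling is `≤ M`), `UVMass Λ k₀ N` (`Σ_{j∈[J,K)} Σ_{i∈[k₀,J)}
Λ_{j,i} ≤ N`), `YoungTail Λ k₀ T` (`Σ_{j∈[J,K)} Σ_{i<k₀} Λ_{j,i} ≤ T J` with `T → 0`) — all three hold for geometric fading AND for the flat profile of (R55) (forward sums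
`Σ_{j≥i} 2∕(j+3)² ≤ 2∕(i+2)`, UV mass `≤ 2J∕(J+2) ≤ 2`, young tail `≤ 2k₀∕(J+2)`; instances in the companion record, elementary).  RESULTS: §2 `king_fixedPoint_summable` — the
window fixed point with a general nonnegative kernel under `M·U ≤ 1∕2` (sup-bounded-in-total feedback, exchange of sums by `ForwardSum`); §3 `discAt_le_window_summable` — node U2 on
the window from `discAt_step` (tree) with the far-UV history influence kept as the source `Σ_{j∈[J,K)} Σ_{i<J} Λ_{j,i}|g^B_{i+n} − g^A_i|`; `farUV_le_summable` — that source is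
`≤ γ·T J + N∕sprof γ b (K+1−J)` by the box on the young scales and asymptotic freedom on the old ones; §4 **`direct_matching_eventually_summable`** — the END of (R51) VERBATIM
(∀ depth M ∀ ε ∃ K₀ ∀ K ≥ K₀ ∀ n ∀ j ∈ [K−M, K]: |g^{(K+n)}_{j+n} − g^{(K)}_j| ≤ ε) from {`UniformShift ω → 0`, `HistLipschitz Λ` with `Λ ≥ 0`, `ForwardSum Λ M`, `UVMass Λ k₀ N`,
`YoungTail Λ k₀ T` with `T → 0`, `EventualLowerH b γ k₀`, box, pin, window `M·((k₀+1)γ³ + 2γ∕b) ≤ 1∕2`} — NO geometric fading, NO rate anywhere on the β-side.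

WHAT THIS SAYS FOR THE ROW (census (R56); classification words UNCHANGED; it REFINES (R55)'s reading): on King's ORIGINAL route (with the asymptotic-freedom binder) node U2's memory
companion need NOT be geometric — forward-summable influence with bounded UV mass and a vanishing young tail suffices —, so the separation «King's β-input HOLDS, NE4 FAILS»
of (R54) DOES survive coupling sensitivity there: (R55)'s flat-memory parabolic family meets every β-side hypothesis of `direct_matching_eventually_summable` in shape
(`uniformShift_transBeta`, `histLipschitz_transBeta`, transBeta ≥ 1∕3) while violating NE4 and geometric fading.  What needs GEOMETRIC fading is the AF-FREE route of (R52)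
(`KingCurrencyGap`: the growing envelope τ^{−depth} must be beaten by the memory) and the consecutive kernel.  So the final form of the currencies' comparison on the autonomous
road: NE4 ⟺-grade hyperbolicity transverse to the coupling ((R53)'s margin); King + AF ⟸ even a coupling-sensitive parabolic direction with forward-summable memory; King
AF-free ⟸ geometric memory, which a coupling-sensitive parabolic direction does not have.  NOT PRINTED; nothing of Bałaban's asserted; NE4 NOT proved.
-/

noncomputable section

namespace Summit.QuantumFields.BalabanUV.T4Continuum.Spine.NE4.KingCurrencySummable

open Finset Filter Topology
open Literature.MathematicalPhysics.QuantumFieldTheory.Balaban1983to89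
open Literature.MathematicalPhysics.QuantumFieldTheory.Balaban1983to89.FlowStep
open Literature.MathematicalPhysics.QuantumFieldTheory.Balaban1983to89.T4CouplingMatching
open Summit.QuantumFields.BalabanUV.T4Continuum.Spine.NE4.KingCurrency
open Summit.QuantumFields.BalabanUV.T4Continuum.Spine.NE4.KingCurrencyAF
  (coupling_le_inv_sprof sprof_monotone exists_inv_sprof_le abs_sub_le_of_pos_le)
open Summit.QuantumFields.BalabanUV.T4Continuum.NE7PairwiseCouplingStep (sum_weightsOff_le_of_eventualLower)

/-! ## §1 The three memory shapes replacing geometric fading -/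

/-- HYPOTHESIS SHAPE — **FORWARD-SUMMABLE MEMORY**: the total FUTURE influence of the coupling born at scale `i` on the β-functions of all later scales below `K` is bounded,
`Σ_{j∈[i,K)} Λ_{j,i} ≤ M`, uniformly in `i` and `K` (geometric fading `Λ_{j,i} ≤ Cθ^{j−i}` gives `M = C∕(1−θ)`; the flat profile `2∕(j+3)²` gives `M = 1`).  NOT PRINTED. [folklore] -/
def ForwardSum (Λ : ℕ → ℕ → ℝ) (M : ℝ) : Prop := ∀ i K : ℕ, ∑ j ∈ Ico i K, Λ j i ≤ M

/-- HYPOTHESIS SHAPE — **ULTRAVIOLET MASS**: the total influence of all scales `k₀ ≤ i < J` on a window `[J, K)` above them is bounded, `Σ_{j∈[J,K)} Σ_{i∈[k₀,J)} Λ_{j,i} ≤ N`,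
uniformly (geometric: `N = Cθ∕(1−θ)²`; flat: `N = 2`).  NOT PRINTED. [folklore] -/
def UVMass (Λ : ℕ → ℕ → ℝ) (k₀ : ℕ) (N : ℝ) : Prop := ∀ J K : ℕ, ∑ j ∈ Ico J K, ∑ i ∈ Ico k₀ J, Λ j i ≤ N

/-- HYPOTHESIS SHAPE — **VANISHING YOUNG TAIL**: the total influence of the first `k₀` couplings on a window `[J, K)` is `≤ T J` (with `T → 0` as the window recedes from them;
geometric: `T J = C·k₀·θ^{J−k₀}∕(1−θ)` for `J ≥ k₀`; flat: `T J = 2k₀∕(J+2)`).  NOT PRINTED. [folklore] -/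
def YoungTail (Λ : ℕ → ℕ → ℝ) (k₀ : ℕ) (T : ℕ → ℝ) : Prop := ∀ J K : ℕ, ∑ j ∈ Ico J K, ∑ i ∈ range k₀, Λ j i ≤ T J

/-! ## §2 The window fixed point with a general kernel -/

/-- **THE WINDOW FIXED POINT WITH A FORWARD-SUMMABLE KERNEL.**  Scales `0 … K`, window `[J, K]`; `x ≥ 0` with `x_K = 0` (the pin); for `J ≤ j < K`
`x_j ≤ x_{j+1} + ω_j + F_j + Σ_{i∈[J,j]} Λ_{j,i}·(u_i x_i)` (sources `ω, F ≥ 0`, kernel `Λ ≥ 0`, weights `u ≥ 0` with `Σ_{i∈[J,K)} u_i ≤ U`), forward sums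
`Σ_{j∈[i,K)} Λ_{j,i} ≤ M` and the smallness `M·U ≤ 1∕2`.  THEN `x_j ≤ 2·Σ_{i∈[J,K)} (ω_i + F_i)` on the window.  (Backward accumulation from the pin by the tree's `backward_sum`;
exchange of the double sum — coupling `i` feeds the accumulated discrepancy at most `M·u_i x_i` in total; bootstrap on the window maximum.)  NO rate, NO geometric kernel. [folklore] -/
theorem king_fixedPoint_summable {K J : ℕ} (hJK : J ≤ K) {x ω F u : ℕ → ℝ} {Λ : ℕ → ℕ → ℝ} {M U : ℝ}
    (hx : ∀ j, 0 ≤ x j) (hω : ∀ j, 0 ≤ ω j) (hF : ∀ j, 0 ≤ F j) (hu : ∀ i, 0 ≤ u i) (hΛ0 : ∀ j i, 0 ≤ Λ j i)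
    (hfwd : ∀ i, J ≤ i → ∑ j ∈ Ico i K, Λ j i ≤ M) (hU : ∑ i ∈ Ico J K, u i ≤ U) (hsmall : M * U ≤ 1 / 2) (hK : x K = 0)
    (hrec : ∀ j, J ≤ j → j < K → x j ≤ x (j + 1) + ω j + F j + ∑ i ∈ Ico J (j + 1), Λ j i * (u i * x i)) :
    ∀ j, J ≤ j → j ≤ K → x j ≤ 2 * ∑ i ∈ Ico J K, (ω i + F i) := by
  obtain ⟨js, hjs, hmax⟩ := Finset.exists_max_image (Icc J K) x ⟨J, Finset.mem_Icc.mpr ⟨le_rfl, hJK⟩⟩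
  set Y := x js with hY
  have hY0 : 0 ≤ Y := hx js
  have hxY : ∀ i, J ≤ i → i ≤ K → x i ≤ Y := fun i hi hiK => hmax i (Finset.mem_Icc.mpr ⟨hi, hiK⟩)
  have hM0 : 0 ≤ M := le_trans (Finset.sum_nonneg fun j _ => hΛ0 j J) (hfwd J le_rfl)
  set s : ℕ → ℝ := fun j => ω j + F j + ∑ i ∈ Ico J (j + 1), Λ j i * (u i * x i) with hs
  have hs0 : ∀ j, 0 ≤ s j := fun j => by
    have h1 : 0 ≤ ∑ i ∈ Ico J (j + 1), Λ j i * (u i * x i) := Finset.sum_nonneg fun i _ => mul_nonneg (hΛ0 j i) (mul_nonneg (hu i) (hx i))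
    simp only [hs]; linarith [hω j, hF j]
  -- backward accumulation on the window
  have hacc : ∀ j, J ≤ j → j ≤ K → x j ≤ ∑ i ∈ Ico J K, s i := by
    have hrec' : ∀ j, j < K → x (max j J) ≤ x (max (j + 1) J) + s j := by
      intro j hj
      by_cases hJj : J ≤ j
      · rw [max_eq_left hJj, max_eq_left (by omega : J ≤ j + 1)]
        simp only [hs]; linarith [hrec j hJj hj]
      · rw [max_eq_right (by omega : j ≤ J), max_eq_right (by omega : j + 1 ≤ J)]; linarith [hs0 j]
    have hKJ : x (max K J) ≤ 0 := by rw [max_eq_left hJK, hK]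
    intro j hJj hjK
    have h := backward_sum (δ := fun j => x (max j J)) hKJ hrec' j hjK
    simp only [max_eq_left hJj] at h
    exact h.trans (Finset.sum_le_sum_of_subset_of_nonneg (Finset.Ico_subset_Ico hJj le_rfl) fun i _ _ => hs0 i)
  -- exchange of sums in the feedback
  have hexch : ∑ j ∈ Ico J K, ∑ i ∈ Ico J (j + 1), Λ j i * (u i * x i) = ∑ i ∈ Ico J K, ∑ j ∈ Ico i K, Λ j i * (u i * x i) := by
    refine Finset.sum_comm' fun j i => ?_
    simp only [Finset.mem_Ico]; omega
  have hfeed : ∑ j ∈ Ico J K, ∑ i ∈ Ico J (j + 1), Λ j i * (u i * x i) ≤ M * (U * Y) := by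
    rw [hexch]
    calc ∑ i ∈ Ico J K, ∑ j ∈ Ico i K, Λ j i * (u i * x i) = ∑ i ∈ Ico J K, (u i * x i) * ∑ j ∈ Ico i K, Λ j i := by
          refine Finset.sum_congr rfl fun i _ => ?_
          rw [Finset.mul_sum]; exact Finset.sum_congr rfl fun j _ => by ring
      _ ≤ ∑ i ∈ Ico J K, (u i * Y) * M := by
          refine Finset.sum_le_sum fun i hi => ?_
          have hJi : J ≤ i := (Finset.mem_Ico.mp hi).1
          have hiK : i ≤ K := (Finset.mem_Ico.mp hi).2.le
          exact mul_le_mul (mul_le_mul_of_nonneg_left (hxY i hJi hiK) (hu i)) (hfwd i hJi)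
            (Finset.sum_nonneg fun j _ => hΛ0 j i) (mul_nonneg (hu i) hY0)
      _ = (∑ i ∈ Ico J K, u i) * Y * M := by rw [Finset.sum_mul, Finset.sum_mul]
      _ ≤ U * Y * M := by gcongr
      _ = M * (U * Y) := by ring
  have htot : ∑ i ∈ Ico J K, s i ≤ ∑ i ∈ Ico J K, (ω i + F i) + M * (U * Y) := by
    have e : ∑ i ∈ Ico J K, s i = ∑ i ∈ Ico J K, (ω i + F i) + ∑ j ∈ Ico J K, ∑ i ∈ Ico J (j + 1), Λ j i * (u i * x i) := by
      simp only [hs, Finset.sum_add_distrib]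
    rw [e]; linarith
  -- bootstrap on the maximum
  have hYle : Y ≤ ∑ i ∈ Ico J K, (ω i + F i) + M * (U * Y) := (hacc js (Finset.mem_Icc.mp hjs).1 (Finset.mem_Icc.mp hjs).2).trans htot
  have hMU : M * (U * Y) ≤ Y / 2 := by
    rw [show M * (U * Y) = (M * U) * Y by ring]; nlinarith [mul_le_mul_of_nonneg_right hsmall hY0]
  have hYfin : Y ≤ 2 * ∑ i ∈ Ico J K, (ω i + F i) := by linarith
  intro j hJj hjK
  exact (hxY j hJj hjK).trans hYfin

/-! ## §3 Node U2 on the window with forward-summable memory; the far-ultraviolet source -/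

/-- **NODE U2 IN KING'S CURRENCY ON A WINDOW, FORWARD-SUMMABLE MEMORY.**  Two runs of (0.20) with the same `β` (A: `K` steps, B: `K + n` steps), couplings in `]0,γ]`, pinned
`g^A_K = g^B_{K+n}`; `UniformShift ω γ β` (`ω ≥ 0`); `HistLipschitz Λ γ β` with `Λ ≥ 0` and `ForwardSum Λ M`; `EventualLowerH b γ k₀ β`; smallness `M·((k₀+1)γ³ + 2γ∕b) ≤ 1∕2`.  THEN on
`[J, K]`, uniformly in `n`: `discAt_j ≤ 2·Σ_{i∈[J,K)} ω_i + 2·Σ_{j′∈[J,K)} Σ_{i<J} Λ_{j′,i}·|g^B_{i+n} − g^A_i|` — window sources plus the far-UV couplings' TOTAL influence on the window.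
(`discAt_step` + `king_fixedPoint_summable`.)  NO geometric fading, NO rate.  β-side hypotheses UNPRINTED. [cite: Balaban1987RG1, (0.20) p.256] -/
theorem discAt_le_window_summable {β : HBeta} {γ b M : ℝ} {ω : ℕ → ℝ} {Λ : ℕ → ℕ → ℝ} {k₀ K n J : ℕ} {gA gB : ℕ → ℝ}
    (hγ : 0 < γ) (hb : 0 < b) (hω : ∀ j, 0 ≤ ω j)
    (hA : RGEqH K β gA) (hB : RGEqH (K + n) β gB)
    (hAbox : ∀ i, i ≤ K → 0 < gA i ∧ gA i ≤ γ) (hBbox : ∀ i, i ≤ K + n → 0 < gB i ∧ gB i ≤ γ) (hpin : gA K = gB (K + n))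
    (hS : UniformShift ω γ β) (hL : HistLipschitz Λ γ β) (hΛ0 : ∀ j i, 0 ≤ Λ j i) (hfwd : ForwardSum Λ M)
    (hlo : EventualLowerH b γ k₀ β) (hsmall : M * (((k₀ : ℝ) + 1) * γ ^ 3 + 2 * γ / b) ≤ 1 / 2) (hJK : J ≤ K) :
    ∀ j, J ≤ j → j ≤ K →
      discAt n gA gB j ≤ 2 * ∑ i ∈ Ico J K, ω i + 2 * ∑ j' ∈ Ico J K, ∑ i ∈ range J, Λ j' i * |gB (i + n) - gA i| := by
  set u : ℕ → ℝ := fun i => (gA i) ^ 2 * |gB (i + n)| with hu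
  have hu0 : ∀ i, 0 ≤ u i := fun i => mul_nonneg (sq_nonneg _) (abs_nonneg _)
  have hueq : ∀ i, i ≤ K → u i = (gA i) ^ 2 * gB (i + n) := fun i hi => by simp only [hu, abs_of_pos (hBbox (i + n) (by omega)).1]
  have hU : ∑ i ∈ Ico J K, u i ≤ ((k₀ : ℝ) + 1) * γ ^ 3 + 2 * γ / b := by
    calc ∑ i ∈ Ico J K, u i ≤ ∑ i ∈ range (K + 1), u i :=
          Finset.sum_le_sum_of_subset_of_nonneg (fun i hi => mem_range.mpr (by have := (Finset.mem_Ico.mp hi).2; omega)) fun i _ _ => hu0 i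
      _ = ∑ i ∈ range (K + 1), (gA i) ^ 2 * gB (i + n) := Finset.sum_congr rfl fun i hi => hueq i (Nat.lt_succ_iff.mp (mem_range.mp hi))
      _ ≤ ((k₀ : ℝ) + 1) * γ ^ 3 + 2 * γ / b := sum_weightsOff_le_of_eventualLower hγ hb hA hB hAbox hBbox hlo
  set F : ℕ → ℝ := fun j => ∑ i ∈ range J, Λ j i * |gB (i + n) - gA i| with hFdef
  have hF0 : ∀ j, 0 ≤ F j := fun j => Finset.sum_nonneg fun i _ => mul_nonneg (hΛ0 j i) (abs_nonneg _)
  have key := king_fixedPoint_summable hJK (discAt_nonneg n gA gB) hω hF0 hu0 hΛ0 (fun i _ => hfwd i K) hU hsmall (discAt_pin hpin) ?_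
  · intro j hJj hjK
    have h := key j hJj hjK
    rw [Finset.sum_add_distrib, mul_add] at h
    exact h
  intro j hJj hjK
  have hstep := discAt_step hA hB hAbox hBbox hS hL hjK
  have hsplit : ∑ i ∈ range (j + 1), Λ j i * |gB (i + n) - gA i|
      = ∑ i ∈ range J, Λ j i * |gB (i + n) - gA i| + ∑ i ∈ Ico J (j + 1), Λ j i * |gB (i + n) - gA i| :=
    (Finset.sum_range_add_sum_Ico _ (by omega : J ≤ j + 1)).symm
  have hnear : ∑ i ∈ Ico J (j + 1), Λ j i * |gB (i + n) - gA i| ≤ ∑ i ∈ Ico J (j + 1), Λ j i * (u i * discAt n gA gB i) := by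
    refine Finset.sum_le_sum fun i hi => ?_
    have hij : i ≤ j := Nat.lt_succ_iff.mp (Finset.mem_Ico.mp hi).2
    have hiK : i ≤ K := hij.trans hjK.le
    have hcap : |gB (i + n) - gA i| ≤ u i * discAt n gA gB i := by
      rw [hueq i hiK]; exact abs_sub_le_weight_mul_discAt (hAbox i hiK).1 (hBbox (i + n) (by omega)).1
    exact mul_le_mul_of_nonneg_left hcap (hΛ0 j i)
  have hFj : ∑ i ∈ range J, Λ j i * |gB (i + n) - gA i| = F j := rfl
  linarith [hstep, hsplit, hnear, hFj]

/-- **THE FAR-ULTRAVIOLET SOURCE**: with `UVMass Λ k₀ N`, `YoungTail Λ k₀ T`, `Λ ≥ 0`, the AF lower bound and `k₀ ≤ J ≤ K`: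
`Σ_{j∈[J,K)} Σ_{i<J} Λ_{j,i}·|g^B_{i+n} − g^A_i| ≤ γ·T J + N·(1∕sprof γ b (K+1−J))` — the first `k₀` scales by the box (`|Δg| ≤ γ`) through the young tail, the scales
`k₀ ≤ i < J` by asymptotic freedom (both couplings `≤ 1∕sprof γ b (K+1−J)`, `coupling_le_inv_sprof`) through the UV mass. [cite: Balaban1987RG1, (0.31) p.259] -/
theorem farUV_le_summable {β : HBeta} {γ b N : ℝ} {T : ℕ → ℝ} {Λ : ℕ → ℕ → ℝ} {k₀ K n J : ℕ} {gA gB : ℕ → ℝ} (hγ : 0 < γ) (hb : 0 < b)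
    (hA : RGEqH K β gA) (hB : RGEqH (K + n) β gB)
    (hAbox : ∀ i, i ≤ K → 0 < gA i ∧ gA i ≤ γ) (hBbox : ∀ i, i ≤ K + n → 0 < gB i ∧ gB i ≤ γ)
    (hlo : EventualLowerH b γ k₀ β) (hΛ0 : ∀ j i, 0 ≤ Λ j i) (hmass : UVMass Λ k₀ N) (htail : YoungTail Λ k₀ T)
    (hk₀J : k₀ ≤ J) (hJK : J ≤ K) :
    ∑ j ∈ Ico J K, ∑ i ∈ range J, Λ j i * |gB (i + n) - gA i| ≤ γ * T J + N * (1 / sprof γ b (K + 1 - J)) := by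
  have hp0 := sprof_pos hγ hb.le
  set s := 1 / sprof γ b (K + 1 - J) with hs
  have hs0 : 0 ≤ s := (one_div_pos.mpr (hp0 _)).le
  -- split every inner sum at k₀
  have hsplit : ∑ j ∈ Ico J K, ∑ i ∈ range J, Λ j i * |gB (i + n) - gA i|
      = ∑ j ∈ Ico J K, ∑ i ∈ range k₀, Λ j i * |gB (i + n) - gA i| + ∑ j ∈ Ico J K, ∑ i ∈ Ico k₀ J, Λ j i * |gB (i + n) - gA i| := by
    rw [← Finset.sum_add_distrib]
    exact Finset.sum_congr rfl fun j _ => (Finset.sum_range_add_sum_Ico _ hk₀J).symm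
  -- young scales: |Δg| ≤ γ
  have hyoung : ∑ j ∈ Ico J K, ∑ i ∈ range k₀, Λ j i * |gB (i + n) - gA i| ≤ γ * T J := by
    calc ∑ j ∈ Ico J K, ∑ i ∈ range k₀, Λ j i * |gB (i + n) - gA i| ≤ ∑ j ∈ Ico J K, ∑ i ∈ range k₀, Λ j i * γ := by
          refine Finset.sum_le_sum fun j _ => Finset.sum_le_sum fun i hi => ?_
          have hi' : i < k₀ := mem_range.mp hi
          have hgA := hAbox i (by omega)
          have hgB := hBbox (i + n) (by omega)
          exact mul_le_mul_of_nonneg_left (abs_sub_le_of_pos_le hgB.1 hgB.2 hgA.1 hgA.2) (hΛ0 j i)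
      _ = (∑ j ∈ Ico J K, ∑ i ∈ range k₀, Λ j i) * γ := by rw [Finset.sum_mul]; exact Finset.sum_congr rfl fun j _ => by rw [Finset.sum_mul]
      _ ≤ T J * γ := mul_le_mul_of_nonneg_right (htail J K) hγ.le
      _ = γ * T J := mul_comm _ _
  -- old scales: both couplings ≤ s by asymptotic freedom
  have hold : ∑ j ∈ Ico J K, ∑ i ∈ Ico k₀ J, Λ j i * |gB (i + n) - gA i| ≤ N * s := by
    calc ∑ j ∈ Ico J K, ∑ i ∈ Ico k₀ J, Λ j i * |gB (i + n) - gA i| ≤ ∑ j ∈ Ico J K, ∑ i ∈ Ico k₀ J, Λ j i * s := by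
          refine Finset.sum_le_sum fun j _ => Finset.sum_le_sum fun i hi => ?_
          have hik : k₀ ≤ i := (Finset.mem_Ico.mp hi).1
          have hiJ : i < J := (Finset.mem_Ico.mp hi).2
          have hgA := hAbox i (by omega)
          have hgB := hBbox (i + n) (by omega)
          have hmono : sprof γ b (K + 1 - J) ≤ sprof γ b (K - i) := sprof_monotone hb.le (by omega)
          have hsi : 1 / sprof γ b (K - i) ≤ s := one_div_le_one_div_of_le (hp0 _) hmono
          have hcA : gA i ≤ s := (coupling_le_inv_sprof hγ hb hA hAbox hlo hik (by omega)).trans hsi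
          have hcB : gB (i + n) ≤ s := by
            have h := coupling_le_inv_sprof hγ hb hB hBbox hlo (i := i + n) (by omega) (by omega)
            rw [show K + n - (i + n) = K - i by omega] at h
            exact h.trans hsi
          exact mul_le_mul_of_nonneg_left (abs_sub_le_of_pos_le hgB.1 hcB hgA.1 hcA) (hΛ0 j i)
      _ = (∑ j ∈ Ico J K, ∑ i ∈ Ico k₀ J, Λ j i) * s := by rw [Finset.sum_mul]; exact Finset.sum_congr rfl fun j _ => by rw [Finset.sum_mul]
      _ ≤ N * s := mul_le_mul_of_nonneg_right (hmass J K) hs0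
  rw [hsplit]; linarith

/-! ## §4 The END of (R51) without geometric fading -/

/-- **NODE U2 IN KING'S CURRENCY — THE END, WITH FORWARD-SUMMABLE MEMORY** (same conclusion as `KingCurrencyWindow.direct_matching_eventually`).  A family of runs `K ↦ g^{(K)}` of
(0.20) with the same `β`, couplings in `]0,γ]`, all pinned at the same renormalized coupling; the RATE-FREE input `UniformShift ω γ β` with `ω ≥ 0`, `ω → 0`; history moduli
`HistLipschitz Λ γ β`, `Λ ≥ 0`, with `ForwardSum Λ M`, `UVMass Λ k₀ N`, `YoungTail Λ k₀ T` (`T → 0`) — NO geometric fading; the AF lower bound `EventualLowerH b γ k₀ β`;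
smallness `M·((k₀+1)γ³ + 2γ∕b) ≤ 1∕2`.  THEN for every depth `Md` and every `ε > 0` there is `K₀` with `|g^{(K+n)}_{j+n} − g^{(K)}_j| ≤ ε` for all `K ≥ K₀`, all `n`, all
`j ∈ [K − Md, K]`.  Every hypothesis about `β` is an UNPRINTED input; no rate is used or produced. [cite: Balaban1987RG1, (0.20) p.256, Thm 2 p.259, (0.31) p.259] -/
theorem direct_matching_eventually_summable {β : HBeta} {γ b M N : ℝ} {ω : ℕ → ℝ} {T : ℕ → ℝ} {Λ : ℕ → ℕ → ℝ} {k₀ : ℕ}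
    (g : ℕ → ℕ → ℝ) (gIR : ℝ) (hγ : 0 < γ) (hb : 0 < b) (hN : 0 ≤ N)
    (hrun : ∀ K, RGEqH K β (g K)) (hbox : ∀ K i, i ≤ K → 0 < g K i ∧ g K i ≤ γ) (hpin : ∀ K, g K K = gIR)
    (hS : UniformShift ω γ β) (hω0 : ∀ j, 0 ≤ ω j) (hωlim : Tendsto ω atTop (𝓝 0))
    (hL : HistLipschitz Λ γ β) (hΛ0 : ∀ j i, 0 ≤ Λ j i) (hfwd : ForwardSum Λ M) (hmass : UVMass Λ k₀ N)
    (htail : YoungTail Λ k₀ T) (hTlim : Tendsto T atTop (𝓝 0))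
    (hlo : EventualLowerH b γ k₀ β) (hsmall : M * (((k₀ : ℝ) + 1) * γ ^ 3 + 2 * γ / b) ≤ 1 / 2) :
    ∀ (Md : ℕ) (ε : ℝ), 0 < ε → ∃ K₀ : ℕ, ∀ K n j : ℕ, K₀ ≤ K → K ≤ j + Md → j ≤ K → |g (K + n) (j + n) - g K j| ≤ ε := by
  intro Md ε hε
  have hγ3 : 0 < γ ^ 3 := by positivity
  set ε₁ := ε / γ ^ 3 with hε₁
  have hε₁pos : 0 < ε₁ := by positivity
  -- (i) the window depth `D` by asymptotic freedom: 2·N·(1∕sprof) ≤ ε₁∕3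
  obtain ⟨D₁, hD₁⟩ := exists_inv_sprof_le hγ hb (ε := ε₁ / 3 / (2 * N + 1)) (by positivity)
  set D := max Md D₁ with hD
  -- (ii) the young tail: 2·γ·T J ≤ ε₁∕3 for J large
  obtain ⟨N₁, hN₁⟩ := Metric.tendsto_atTop.mp hTlim (ε₁ / 3 / (2 * γ)) (by positivity)
  -- (iii) the window sources
  obtain ⟨N₂, hN₂⟩ := Metric.tendsto_atTop.mp hωlim (ε₁ / 3 / (2 * ((D : ℝ) + 1))) (by positivity)
  refine ⟨N₁ + N₂ + D + k₀, fun K n j hK hjM hjK => ?_⟩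
  set J := K - D with hJ
  have hJK : J ≤ K := Nat.sub_le K D
  have hk₀J : k₀ ≤ J := by omega
  have hJj : J ≤ j := by have : Md ≤ D := le_max_left _ _; omega
  have hwin := discAt_le_window_summable hγ hb hω0 (hrun K) (hrun (K + n)) (hbox K) (hbox (K + n)) ((hpin K).trans (hpin (K + n)).symm)
    hS hL hΛ0 hfwd hlo hsmall hJK j hJj hjK
  have hfar := farUV_le_summable hγ hb (hrun K) (hrun (K + n)) (hbox K) (hbox (K + n)) hlo hΛ0 hmass htail hk₀J hJK
  -- (iii) window sources small
  have hsrc : 2 * ∑ i ∈ Ico J K, ω i ≤ ε₁ / 3 := by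
    have hωi : ∀ i ∈ Ico J K, ω i ≤ ε₁ / 3 / (2 * ((D : ℝ) + 1)) := by
      intro i hi
      have hiN : N₂ ≤ i := by have := (Finset.mem_Ico.mp hi).1; omega
      have h := hN₂ i hiN
      rw [Real.dist_eq, sub_zero] at h
      exact (le_abs_self _).trans h.le
    have hcard : ((Ico J K).card : ℝ) ≤ (D : ℝ) := by rw [Nat.card_Ico]; exact_mod_cast (by omega : K - J ≤ D)
    calc 2 * ∑ i ∈ Ico J K, ω i ≤ 2 * ∑ i ∈ Ico J K, ε₁ / 3 / (2 * ((D : ℝ) + 1)) := mul_le_mul_of_nonneg_left (Finset.sum_le_sum hωi) (by norm_num)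
      _ = 2 * ((Ico J K).card * (ε₁ / 3 / (2 * ((D : ℝ) + 1)))) := by rw [Finset.sum_const, nsmul_eq_mul]
      _ ≤ 2 * ((D : ℝ) * (ε₁ / 3 / (2 * ((D : ℝ) + 1)))) := mul_le_mul_of_nonneg_left (mul_le_mul_of_nonneg_right hcard (by positivity)) (by norm_num)
      _ = (D : ℝ) / ((D : ℝ) + 1) * (ε₁ / 3) := by field_simp
      _ ≤ 1 * (ε₁ / 3) := by
          refine mul_le_mul_of_nonneg_right ?_ (by positivity)
          rw [div_le_one (by positivity)]; linarith
      _ = ε₁ / 3 := one_mul _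
  -- (ii) young tail small
  have hyoung : 2 * (γ * T J) ≤ ε₁ / 3 := by
    have hJN : N₁ ≤ J := by omega
    have h := hN₁ J hJN
    rw [Real.dist_eq, sub_zero] at h
    have hT : T J ≤ ε₁ / 3 / (2 * γ) := (le_abs_self _).trans h.le
    calc 2 * (γ * T J) = (2 * γ) * T J := by ring
      _ ≤ (2 * γ) * (ε₁ / 3 / (2 * γ)) := mul_le_mul_of_nonneg_left hT (by positivity)
      _ = ε₁ / 3 := by field_simp
  -- (i) old scales small by asymptotic freedom
  have hold : 2 * (N * (1 / sprof γ b (K + 1 - J))) ≤ ε₁ / 3 := by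
    have hKJ : D₁ ≤ K + 1 - J := by have : D₁ ≤ D := le_max_right _ _; omega
    have h := hD₁ (K + 1 - J) hKJ
    calc 2 * (N * (1 / sprof γ b (K + 1 - J))) = (2 * N) * (1 / sprof γ b (K + 1 - J)) := by ring
      _ ≤ (2 * N) * (ε₁ / 3 / (2 * N + 1)) := mul_le_mul_of_nonneg_left h (by positivity)
      _ = (2 * N) / (2 * N + 1) * (ε₁ / 3) := by ring
      _ ≤ 1 * (ε₁ / 3) := by
          refine mul_le_mul_of_nonneg_right ?_ (by positivity)
          rw [div_le_one (by positivity)]; linarith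
      _ = ε₁ / 3 := one_mul _
  have hdisc : discAt n (g K) (g (K + n)) j ≤ ε₁ := by
    have h2 := mul_le_mul_of_nonneg_left hfar (by norm_num : (0 : ℝ) ≤ 2)
    rw [mul_add] at h2
    linarith
  have hgA := hbox K j hjK
  have hgB := hbox (K + n) (j + n) (by omega)
  have hw : (g K j) ^ 2 * g (K + n) (j + n) ≤ γ ^ 3 := by
    calc (g K j) ^ 2 * g (K + n) (j + n) ≤ γ ^ 2 * γ := mul_le_mul (pow_le_pow_left₀ hgA.1.le hgA.2 2) hgB.2 hgB.1.le (sq_nonneg γ)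
      _ = γ ^ 3 := by ring
  calc |g (K + n) (j + n) - g K j| ≤ (g K j) ^ 2 * g (K + n) (j + n) * discAt n (g K) (g (K + n)) j := abs_sub_le_weight_mul_discAt hgA.1 hgB.1
    _ ≤ γ ^ 3 * ε₁ := mul_le_mul hw hdisc (discAt_nonneg _ _ _ _) hγ3.le
    _ = ε := by rw [hε₁]; field_simp

/-! ## §5 Instances: the FLAT profile of (R55) and geometric fading both qualify -/

/-- [bookkeeping] Telescoping: `Σ_{j∈[i,K)} 2∕(j+3)² ≤ 2∕(i+2) − 2∕(K+2)` for `i ≤ K` (each term `≤ 2∕(j+2) − 2∕(j+3)`). [folklore] -/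
theorem sum_flat_Ico_le {i K : ℕ} (hiK : i ≤ K) :
    ∑ j ∈ Ico i K, 2 / ((j : ℝ) + 3) ^ 2 ≤ 2 / ((i : ℝ) + 2) - 2 / ((K : ℝ) + 2) := by
  induction K, hiK using Nat.le_induction with
  | base => simp
  | succ K hiK ih =>
    rw [Finset.sum_Ico_succ_top hiK]
    have hK2 : (0 : ℝ) < (K : ℝ) + 2 := by positivity
    have hK3 : (0 : ℝ) < (K : ℝ) + 3 := by positivity
    have hterm : 2 / ((K : ℝ) + 3) ^ 2 ≤ 2 / ((K : ℝ) + 2) - 2 / ((K : ℝ) + 3) := by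
      rw [div_sub_div _ _ hK2.ne' hK3.ne', div_le_div_iff₀ (by positivity) (by positivity)]
      nlinarith
    push_cast
    rw [show (K : ℝ) + 1 + 2 = (K : ℝ) + 3 by ring]
    linarith

/-- **THE FLAT PROFILE IS FORWARD-SUMMABLE**: `ForwardSum (fun k _ ↦ 2∕(k+3)²) 1` — (R55)'s `histLipschitz_transBeta` modulus. [folklore] -/
theorem forwardSum_flat : ForwardSum (fun k _ => 2 / ((k : ℝ) + 3) ^ 2) 1 := by
  intro i K
  by_cases hiK : i ≤ K
  · have h := sum_flat_Ico_le hiK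
    have h1 : 2 / ((i : ℝ) + 2) ≤ 1 := by
      rw [div_le_one (by positivity)]; linarith [(Nat.cast_nonneg i : (0 : ℝ) ≤ i)]
    have h2 : 0 ≤ 2 / ((K : ℝ) + 2) := by positivity
    exact h.trans (by linarith)
  · rw [Finset.Ico_eq_empty (by omega), Finset.sum_empty]; norm_num

/-- **THE FLAT PROFILE HAS UV MASS ≤ 2**: `Σ_{j∈[J,K)} Σ_{i∈[k₀,J)} 2∕(j+3)² ≤ J·2∕(J+2) ≤ 2`. [folklore] -/
theorem uvMass_flat (k₀ : ℕ) : UVMass (fun k _ => 2 / ((k : ℝ) + 3) ^ 2) k₀ 2 := by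
  intro J K
  have hinner : ∀ j, ∑ _i ∈ Ico k₀ J, 2 / ((j : ℝ) + 3) ^ 2 ≤ (J : ℝ) * (2 / ((j : ℝ) + 3) ^ 2) := fun j => by
    rw [Finset.sum_const, nsmul_eq_mul, Nat.card_Ico]
    exact mul_le_mul_of_nonneg_right (by exact_mod_cast Nat.sub_le J k₀) (by positivity)
  by_cases hJK : J ≤ K
  · calc ∑ j ∈ Ico J K, ∑ _i ∈ Ico k₀ J, 2 / ((j : ℝ) + 3) ^ 2 ≤ ∑ j ∈ Ico J K, (J : ℝ) * (2 / ((j : ℝ) + 3) ^ 2) := Finset.sum_le_sum fun j _ => hinner j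
      _ = (J : ℝ) * ∑ j ∈ Ico J K, 2 / ((j : ℝ) + 3) ^ 2 := by rw [Finset.mul_sum]
      _ ≤ (J : ℝ) * (2 / ((J : ℝ) + 2)) := by
          refine mul_le_mul_of_nonneg_left ((sum_flat_Ico_le hJK).trans ?_) (by positivity)
          have : 0 ≤ 2 / ((K : ℝ) + 2) := by positivity
          linarith
      _ ≤ 2 := by rw [← mul_div_assoc, div_le_iff₀ (by positivity)]; nlinarith
  · rw [Finset.Ico_eq_empty (by omega), Finset.sum_empty]; norm_num

/-- **THE FLAT PROFILE HAS A VANISHING YOUNG TAIL**: `YoungTail (fun k _ ↦ 2∕(k+3)²) k₀ (fun J ↦ 2k₀∕(J+2))`, and `2k₀∕(J+2) → 0`. [folklore] -/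
theorem youngTail_flat (k₀ : ℕ) : YoungTail (fun k _ => 2 / ((k : ℝ) + 3) ^ 2) k₀ (fun J => 2 * (k₀ : ℝ) / ((J : ℝ) + 2)) := by
  intro J K
  simp only [Finset.sum_const, Finset.card_range, nsmul_eq_mul]
  by_cases hJK : J ≤ K
  · rw [← Finset.mul_sum]
    calc (k₀ : ℝ) * ∑ j ∈ Ico J K, 2 / ((j : ℝ) + 3) ^ 2 ≤ (k₀ : ℝ) * (2 / ((J : ℝ) + 2)) := by
          refine mul_le_mul_of_nonneg_left ((sum_flat_Ico_le hJK).trans ?_) (by positivity)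
          have : 0 ≤ 2 / ((K : ℝ) + 2) := by positivity
          linarith
      _ = 2 * (k₀ : ℝ) / ((J : ℝ) + 2) := by ring
  · rw [Finset.Ico_eq_empty (by omega), Finset.sum_empty]; positivity

/-- [bookkeeping] … and the young-tail bound tends to `0`. [folklore] -/
theorem tendsto_youngTail_flat (k₀ : ℕ) : Tendsto (fun J : ℕ => 2 * (k₀ : ℝ) / ((J : ℝ) + 2)) atTop (𝓝 0) := by
  have h : Tendsto (fun J : ℕ => (2 * (k₀ : ℝ)) / ((J + 2 : ℕ) : ℝ)) atTop (𝓝 0) :=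
    (tendsto_const_div_atTop_nhds_zero_nat (2 * (k₀ : ℝ))).comp (tendsto_add_atTop_nat 2)
  refine Tendsto.congr (fun J => ?_) h
  push_cast; ring

/-- **GEOMETRIC FADING IS FORWARD-SUMMABLE**: `FadingMemory C θ Λ` (`0 ≤ θ < 1`) gives `ForwardSum Λ (C∕(1−θ))` — (R51)'s hypothesis is a special case of §1's on the window
feedback (the tree's `sum_Ico_pow_sub_le`). [folklore] -/
theorem forwardSum_of_fadingMemory {Λ : ℕ → ℕ → ℝ} {C θ : ℝ} (hθ0 : 0 ≤ θ) (hθ1 : θ < 1) (hΛ : FadingMemory C θ Λ) : ForwardSum Λ (C / (1 - θ)) := by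
  intro i K
  have hC : 0 ≤ C := by have h := hΛ 0 0 le_rfl; rw [Nat.sub_zero, pow_zero, mul_one] at h; exact h.1.trans h.2
  calc ∑ j ∈ Ico i K, Λ j i ≤ ∑ j ∈ Ico i K, C * θ ^ (j - i) := Finset.sum_le_sum fun j hj => (hΛ j i (Finset.mem_Ico.mp hj).1).2
    _ = C * ∑ j ∈ Ico i K, θ ^ (j - i) := by rw [Finset.mul_sum]
    _ ≤ C * (1 / (1 - θ)) := mul_le_mul_of_nonneg_left (sum_Ico_pow_sub_le hθ0 hθ1 le_rfl) hC
    _ = C / (1 - θ) := by ring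

end Summit.QuantumFields.BalabanUV.T4Continuum.Spine.NE4.KingCurrencySummable

end
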